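import Literature.Analysis.FluidPDE.GaussianVortexLinearLam

/-!
# The weighted space `L²(∞;λ)` of Gallay–Maekawa: the weight `G_λ` is a probability density and
# `L²(∞;λ) ⊆ L¹ ∩ L²`

Companion of `Literature.Analysis.FluidPDE.GaussianVortexPlanar` (named fact
`GallayMaekawa2016_thm41`, work unit `provefact GallayMaekawa2016_thm41`). Gallay–Maekawa 2016,
(4.5)–(4.6) (PDF p. 15): `G_λ(x) = (1−λ)/(4π) e^{−(1−λ)|x|²/4}` and
`L²(∞;λ) = {f ∈ L²(ℝ²) : ∫ |f|²/G_λ < ∞}`. For the vendored `gaussWeightLam`, `MemL2InftyLam`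
we prove, for `λ < 1`:

* `gaussWeightLam_pos`, `gaussWeightLam_le`: `0 < G_λ ≤ (1−λ)/(4π)`;
* `integral_gaussWeightLam`: **`∫ G_λ = 1`** (diagonal Gaussian integral,
  `integral_exp_neg_quadratic`); `integrable_gaussWeightLam`;
* `MemL2InftyLam.integrable`: **`L²(∞;λ) ⊆ L¹(ℝ²)`** (pointwise AM–GM
  `|f| ≤ ½(f²/G_λ + G_λ)`), so the mass `∫ f` in (4.2) is a genuine integral for every
  `f ∈ L²(∞;λ)`, and `MemL2InftyLam.integrable_sq`: **`L²(∞;λ) ⊆ L²(ℝ²)`**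
  (`f² ≤ (1−λ)/(4π) · f²/G_λ`), matching the printed definition (4.6) as a subspace of `L²(ℝ²)`.

## References

* Th. Gallay, Y. Maekawa, *Existence and stability of viscous vortices*, arXiv:1610.08384, §4.1,
  (4.5)–(4.6) (PDF p. 15). [GallayMaekawa2016]
-/

noncomputable section

open Set Function Filter MeasureTheory Metric
open scoped InnerProductSpace RealInnerProductSpace Topology

namespace Literature.Analysis.FluidPDE

section Weight

variable {lam : ℝ} (hlam : lam < 1)
include hlam

/-- `G_λ > 0` for `λ < 1`. [folklore] -/
theorem gaussWeightLam_pos (x : EuclideanSpace ℝ (Fin 2)) : 0 < gaussWeightLam lam x := by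
  unfold gaussWeightLam
  have : 0 < 1 - lam := by linarith
  positivity

/-- `G_λ ≤ G_λ(0) = (1−λ)/(4π)` for `λ < 1`. [folklore] -/
theorem gaussWeightLam_le (x : EuclideanSpace ℝ (Fin 2)) :
    gaussWeightLam lam x ≤ (1 - lam) / (4 * Real.pi) := by
  unfold gaussWeightLam
  have h1 : 0 < 1 - lam := by linarith
  have h : Real.exp (-((1 - lam) / 4 * ‖x‖ ^ 2)) ≤ 1 :=
    Real.exp_le_one_iff.2 (neg_nonpos.2 (by positivity))
  calc (1 - lam) / (4 * Real.pi) * Real.exp (-((1 - lam) / 4 * ‖x‖ ^ 2))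
      ≤ (1 - lam) / (4 * Real.pi) * 1 := by gcongr
    _ = (1 - lam) / (4 * Real.pi) := mul_one _

omit hlam in
/-- `G_λ` in coordinates: a diagonal Gaussian with equal rates `(1−λ)/4`. [folklore] -/
theorem gaussWeightLam_eq (x : EuclideanSpace ℝ (Fin 2)) :
    gaussWeightLam lam x = (1 - lam) / (4 * Real.pi) *
      Real.exp (-((1 - lam) / 4 * x 0 ^ 2 + (1 - lam) / 4 * x 1 ^ 2)) := by
  have hn : ‖x‖ ^ 2 = x 0 ^ 2 + x 1 ^ 2 := by
    rw [EuclideanSpace.norm_sq_eq]; simp [Fin.sum_univ_two]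
  rw [gaussWeightLam, hn]
  congr 1
  ring_nf

/-- `G_λ` is integrable for `λ < 1`. [folklore] -/
theorem integrable_gaussWeightLam : Integrable (gaussWeightLam lam) := by
  have h1 : 0 < (1 - lam) / 4 := by linarith
  rw [show gaussWeightLam lam = _ from funext gaussWeightLam_eq]
  exact (integrable_exp_neg_quadratic h1 h1).const_mul _

/-- **`∫ G_λ = 1`**: the weight of `L²(∞;λ)` is a probability density (Gallay–Maekawa 2016,
(4.5); for `λ = 0` this is `∫ G = 1`). [cite: GallayMaekawa2016, (4.5)] -/
theorem integral_gaussWeightLam : ∫ x, gaussWeightLam lam x = 1 := by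
  have h1 : 0 < (1 - lam) / 4 := by linarith
  have hl : (1 - lam) ≠ 0 := by linarith
  have hpi : Real.pi ≠ 0 := Real.pi_pos.ne'
  simp_rw [gaussWeightLam_eq]
  rw [integral_const_mul, integral_exp_neg_quadratic, ← pow_two,
    Real.sq_sqrt (by positivity)]
  field_simp

end Weight

/-- **`L²(∞;λ) ⊆ L¹(ℝ²)`** for `λ < 1`: by AM–GM `|f| ≤ ½ (f²/G_λ + G_λ)` pointwise, and both
terms are integrable. In particular the mass `∫ f` of (4.2) is a genuine integral on `L²(∞;λ)`.
[folklore] -/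
theorem MemL2InftyLam.integrable {lam : ℝ} (hlam : lam < 1) {f : EuclideanSpace ℝ (Fin 2) → ℝ}
    (hf : MemL2InftyLam lam f) : Integrable f := by
  obtain ⟨hfm, hfi⟩ := hf
  refine Integrable.mono' ((hfi.add (integrable_gaussWeightLam hlam)).div_const 2) hfm
    (Eventually.of_forall fun x => ?_)
  have hG := gaussWeightLam_pos hlam x
  rw [Real.norm_eq_abs, Pi.add_apply]
  -- AM–GM: `|f| ≤ (f²/G + G)/2` since `(|f| − G)² ≥ 0`
  rw [le_div_iff₀ (by norm_num : (0 : ℝ) < 2), div_add' _ _ _ hG.ne', le_div_iff₀ hG]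
  nlinarith [sq_nonneg (|f x| - gaussWeightLam lam x), sq_abs (f x)]

/-- **`L²(∞;λ) ⊆ L²(ℝ²)`** for `λ < 1`: `f² ≤ (1−λ)/(4π) · f²/G_λ` pointwise (Gallay–Maekawa 2016,
(4.6) defines `L²(∞;λ)` inside `L²(ℝ²)`). [cite: GallayMaekawa2016, (4.6)] -/
theorem MemL2InftyLam.integrable_sq {lam : ℝ} (hlam : lam < 1) {f : EuclideanSpace ℝ (Fin 2) → ℝ}
    (hf : MemL2InftyLam lam f) : Integrable fun x => f x ^ 2 := by
  obtain ⟨hfm, hfi⟩ := hf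
  refine Integrable.mono' (hfi.const_mul ((1 - lam) / (4 * Real.pi))) (hfm.pow 2)
    (Eventually.of_forall fun x => ?_)
  have hG := gaussWeightLam_pos hlam x
  rw [Real.norm_eq_abs, abs_of_nonneg (sq_nonneg _)]
  calc f x ^ 2 = gaussWeightLam lam x * (f x ^ 2 / gaussWeightLam lam x) := by
        field_simp
    _ ≤ (1 - lam) / (4 * Real.pi) * (f x ^ 2 / gaussWeightLam lam x) :=
        mul_le_mul_of_nonneg_right (gaussWeightLam_le hlam x) (by positivity)

end Literature.Analysis.FluidPDE
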